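import Mathlib
import Literature.Computability.AlgebraicComplexity.GroupTheoreticMatMul
import Summits.MatrixMultiplication.MatrixMultiplication.Theses.ThinBlockAlpha

/-!
# Crux triage r1/k2 — kernel-checked findings for crux `ThinPackings` (stmt-MatrixMultiplication-10595)

Part A (idea `ruled-graph-thin-designs`): the filed transferred statement C⁺ =
`RuledGraphThinDesigns` of `Cruxes/ThinPackings/Ideator1Sketch.lean` is FALSE.  The defs
`Pl`, `Condition`, `RuledGraphThinDesigns` below are VERBATIM copies of the sketch's.  Mechanism:
in `Condition` take the pattern `(i, j, k) := (i, k, k)` with `x = x' = 0`, `y = y'`: every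
unpunctured `A`-leg meets the vertical axis `{0} × V` in `(0, f i 0)`, where all the multiplier
legs `B i = {0} × W i` live, so the `L` sets `f i 0 - W i` are pairwise disjoint in `V`:
`L · M ≤ |V|`, i.e. `|H| = q² |V| ≥ L · N² · M` — the coset bound the crux must beat.  With the
size clause `q² |V| ≤ L q^{2+η}` this forces `M ≤ q^η < q^a` whenever `η < a`.

Part B (idea `vandermonde-patterned-arcs`): the filed C⁺ = `PatternedArcTight` of
`Cruxes/ThinPackings/SketchIdeator2.lean` (verbatim copy below) only asks the middle scalar set
`S` to be NONEMPTY, so it is trivially TRUE: one block (`L = 1`) of two coordinate axes in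
`(ZMod p)²` with `S = {1}`, `p` a prime `> 4^{1/η} + 1`.  Hence the stub
`PatternedArcTransfer : PatternedArcTight → ThinPackings` is the crux itself in costume.

Part C (idea `label-weighted-stpp-debordering`): `IsLabelWeightedSTPP`, `STPPIsWeighted` are
verbatim copies from `Cruxes/ThinPackings/Ideator3Sketch.lean`.  `isSTPP_comp_of_const_potentials`:
re-indexed along an injection on whose image the potentials `(κ, μ)` are constant, a label-weighted
family is a genuine `IsSTPP` family (same group, no tensor power) — so a weighted family with
potentials in `[-R, R]²` contains an `IsSTPP` sub-family of `≥ L/(2R+1)²` blocks and the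
relaxation has content only for potentials with `N^{Ω(1)}` distinct values.
`not_stppIsWeighted`: the card's sanity stub is false as typed (empty third leg makes `IsSTPP`
vacuous but not packing clause (1)); `isLabelWeightedSTPP_of_isSTPP` is the repaired statement
(all legs nonempty).
-/

set_option linter.dupNamespace false

open Literature.Computability.AlgebraicComplexity

namespace Summit.MatrixMultiplication.MatrixMultiplication.Cruxes.ThinPackings.Triage2

/-! ## Part A — `¬ RuledGraphThinDesigns` -/

/-- The incidence plane (verbatim from Ideator1Sketch). -/
abbrev Pl (q : ℕ) : Type := ZMod q × ZMod q

section Legs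

variable {q : ℕ} [NeZero q] {V : Type} [AddCommGroup V] [DecidableEq V]

/-- The STPP clause in ruled-graph coordinates (verbatim from Ideator1Sketch). -/
def Condition {L : ℕ} (d e : Fin L → Pl q) (f g : Fin L → ZMod q → V)
    (W : Fin L → Finset V) : Prop :=
  ∀ i j k : Fin L, ∀ x x' y y' : ZMod q, ∀ w ∈ W i, ∀ w' ∈ W j,
    (x' • d i - x • d k) + (y' • e k - y • e j) = 0 →
    (f i x' - f k x) + (w' - w) + (g k y' - g j y) = 0 →
    i = j ∧ j = k ∧ x = x' ∧ y = y' ∧ w = w'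

end Legs

/-- C⁺ of the card (verbatim from Ideator1Sketch). -/
def RuledGraphThinDesigns : Prop :=
  ∀ a : ℝ, 0 ≤ a → a < 1 → ∀ η : ℝ, 0 < η →
    ∃ (q : ℕ) (_ : NeZero q) (V : Type) (_ : AddCommGroup V) (_ : Fintype V) (_ : DecidableEq V)
      (L M : ℕ) (d e : Fin L → Pl q) (f g : Fin L → ZMod q → V) (W : Fin L → Finset V),
      2 ≤ q ∧ (∀ i, (W i).Nonempty) ∧ Condition d e f g W ∧ (∀ i, (W i).card = M) ∧
        (q : ℝ) ^ a ≤ M ∧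
        (q : ℝ) ^ 2 * Fintype.card V ≤ L * (q : ℝ) ^ (2 + η)

/-- **Vertical-axis packing** (the VM-cap conjecture of the card, with constant `1`):
`Condition` forces `∑ᵢ |W i| ≤ |V|`, because `(i, w) ↦ f i 0 - w` is injective
(pattern `(i, k, k)`, `x = x' = 0`, `y = y'`). [new, elementary] -/
theorem sum_card_W_le_card {q : ℕ} [NeZero q] {V : Type} [AddCommGroup V] [Fintype V]
    [DecidableEq V] {L : ℕ} {d e : Fin L → Pl q} {f g : Fin L → ZMod q → V}
    {W : Fin L → Finset V} (hC : Condition d e f g W) :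
    ∑ i, (W i).card ≤ Fintype.card V := by
  classical
  have hinj : Set.InjOn (fun x : (Σ _ : Fin L, V) => f x.1 0 - x.2)
      ↑(Finset.univ.sigma W) := by
    rintro ⟨i, w⟩ hx ⟨k, w'⟩ hy hxy
    rw [Finset.mem_coe, Finset.mem_sigma] at hx hy
    have hw : w ∈ W i := hx.2
    have hw' : w' ∈ W k := hy.2
    change f i 0 - w = f k 0 - w' at hxy
    have hpl : ((0 : ZMod q) • d i - (0 : ZMod q) • d k) +
        ((0 : ZMod q) • e k - (0 : ZMod q) • e k) = 0 := by simp
    have hval : (f i 0 - f k 0) + (w' - w) + (g k 0 - g k 0) = 0 := by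
      have e1 : (f i 0 - f k 0) + (w' - w) + (g k 0 - g k 0) = (f i 0 - w) - (f k 0 - w') := by
        abel
      rw [e1, hxy, sub_self]
    obtain ⟨hik, -, -, -, hww⟩ := hC i k k 0 0 0 0 w hw w' hw' hpl hval
    subst hik
    subst hww
    rfl
  calc ∑ i, (W i).card = (Finset.univ.sigma W).card := by rw [Finset.card_sigma]
    _ = ((Finset.univ.sigma W).image fun x : (Σ _ : Fin L, V) => f x.1 0 - x.2).card :=
        (Finset.card_image_of_injOn hinj).symm
    _ ≤ Fintype.card V := Finset.card_le_univ _

/-- Coset bound inside the model: `L · M ≤ |V|`, hence `|Pl q × V| = q² |V| ≥ L · q² · M`. -/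
theorem L_mul_M_le_card {q : ℕ} [NeZero q] {V : Type} [AddCommGroup V] [Fintype V]
    [DecidableEq V] {L M : ℕ} {d e : Fin L → Pl q} {f g : Fin L → ZMod q → V}
    {W : Fin L → Finset V} (hC : Condition d e f g W) (hW : ∀ i, (W i).card = M) :
    L * M ≤ Fintype.card V := by
  have h := sum_card_W_le_card hC
  simpa [hW, Finset.sum_const, Finset.card_univ, Fintype.card_fin, smul_eq_mul] using h

/-- **The filed C⁺ of `ruled-graph-thin-designs` is false** (at `a = 1/2`, `η = 1/4`; the same
argument kills every `(a, η)` with `η < a`). [new, elementary] -/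
theorem not_ruledGraphThinDesigns : ¬ RuledGraphThinDesigns := by
  intro h
  obtain ⟨q, _, V, _, _, _, L, M, d, e, f, g, W, hq, -, hC, hWM, hM, hP⟩ :=
    h (1 / 2) (by norm_num) (by norm_num) (1 / 4) (by norm_num)
  have hLM : (L : ℝ) * M ≤ Fintype.card V := by exact_mod_cast L_mul_M_le_card hC hWM
  have hq2 : (2 : ℝ) ≤ q := by exact_mod_cast hq
  have hq1 : (1 : ℝ) < q := by linarith
  have hqpos : (0 : ℝ) < q := by linarith
  have hV1 : (1 : ℝ) ≤ Fintype.card V := by exact_mod_cast Fintype.card_pos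
  have hsplit : (q : ℝ) ^ (2 + 1 / 4 : ℝ) = (q : ℝ) ^ 2 * (q : ℝ) ^ (1 / 4 : ℝ) := by
    rw [Real.rpow_add hqpos, Real.rpow_two]
  -- `L ≥ 1`
  have hL : (1 : ℝ) ≤ L := by
    by_contra hL0
    have hL0' : L = 0 := by
      have : (L : ℝ) < 1 := not_le.mp hL0
      have : L < 1 := by exact_mod_cast this
      omega
    rw [hL0', Nat.cast_zero, zero_mul] at hP
    have hpos : (0 : ℝ) < (q : ℝ) ^ 2 * (Fintype.card V : ℝ) := mul_pos (by positivity) (by linarith)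
    linarith
  have hLpos : (0 : ℝ) < L := by linarith
  -- `|V| ≤ L q^{1/4}`
  have hV : (Fintype.card V : ℝ) ≤ L * (q : ℝ) ^ (1 / 4 : ℝ) := by
    have h1 : (q : ℝ) ^ 2 * Fintype.card V ≤ (q : ℝ) ^ 2 * (L * (q : ℝ) ^ (1 / 4 : ℝ)) := by
      calc (q : ℝ) ^ 2 * Fintype.card V ≤ L * (q : ℝ) ^ (2 + 1 / 4 : ℝ) := hP
        _ = (q : ℝ) ^ 2 * (L * (q : ℝ) ^ (1 / 4 : ℝ)) := by rw [hsplit]; ring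
    exact le_of_mul_le_mul_left h1 (by positivity)
  -- hence `M ≤ q^{1/4} < q^{1/2} ≤ M`
  have hM' : (M : ℝ) ≤ (q : ℝ) ^ (1 / 4 : ℝ) :=
    le_of_mul_le_mul_left (hLM.trans hV) hLpos
  have hlt : (q : ℝ) ^ (1 / 4 : ℝ) < (q : ℝ) ^ (1 / 2 : ℝ) :=
    Real.rpow_lt_rpow_of_exponent_lt hq1 (by norm_num)
  linarith

/-! ## Part B — `PatternedArcTight` is trivially true -/

/-- C⁺ of the card `vandermonde-patterned-arcs` (verbatim from SketchIdeator2; note that `S` is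
only required to be nonempty). -/
def PatternedArcTight : Prop :=
  ∀ η : ℝ, 0 < η → ∃ (F : Type) (_ : Field F) (_ : Fintype F) (_ : DecidableEq F) (n L : ℕ)
    (x y z : Fin L → (Fin n → F)) (S : Finset F),
      (0 : F) ∉ S ∧ S.Nonempty ∧
      IsSTPP (fun i => (Finset.univ.filter (· ≠ (0 : F))).image (fun t => t • x i))
             (fun i => S.image (fun s => s • y i))
             (fun i => (Finset.univ.filter (· ≠ (0 : F))).image (fun r => r • z i)) ∧
      (∀ i, ((Finset.univ.filter (· ≠ (0 : F))).image (fun t => t • x i)).card = Fintype.card F - 1 ∧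
            ((Finset.univ.filter (· ≠ (0 : F))).image (fun r => r • z i)).card = Fintype.card F - 1) ∧
      3 ≤ Fintype.card F ∧
      (Fintype.card (Fin n → F) : ℝ) ≤ L * ((Fintype.card F - 1 : ℕ) : ℝ) ^ (2 + η)

/-- One block of two coordinate axes is a TPP triple: the `IsSTPP` clause for `L = 1`,
`x = (1,0)`, `z = (0,1)`, `S = {1}` in `F²`. -/
theorem axes_isSTPP (F : Type) [Field F] [Fintype F] [DecidableEq F] (yv : Fin 2 → F) :
    IsSTPP (fun _ : Fin 1 => (Finset.univ.filter (· ≠ (0 : F))).image (fun t => t • ![(1 : F), 0]))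
           (fun _ : Fin 1 => ({(1 : F)} : Finset F).image (fun s => s • yv))
           (fun _ : Fin 1 => (Finset.univ.filter (· ≠ (0 : F))).image (fun r => r • ![(0 : F), 1])) := by
  intro i j k s hs s' hs' t ht t' ht' u hu u' hu' hrel
  have hi : i = 0 := Subsingleton.elim _ _
  have hj : j = 0 := Subsingleton.elim _ _
  have hk : k = 0 := Subsingleton.elim _ _
  subst hi; subst hj; subst hk
  simp only [Finset.mem_image, Finset.mem_filter, Finset.mem_univ, true_and,
    Finset.mem_singleton] at hs hs' ht ht' hu hu'
  obtain ⟨a, -, rfl⟩ := hs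
  obtain ⟨a', -, rfl⟩ := hs'
  obtain ⟨b, rfl, rfl⟩ := ht
  obtain ⟨b', rfl, rfl⟩ := ht'
  obtain ⟨c, -, rfl⟩ := hu
  obtain ⟨c', -, rfl⟩ := hu'
  have h0 := congrFun hrel 0
  have h1 := congrFun hrel 1
  simp [Matrix.cons_val_zero, Matrix.cons_val_one, Matrix.head_cons] at h0 h1
  refine ⟨rfl, rfl, ?_, rfl, ?_⟩
  · have : a = a' := by linear_combination -h0
    subst this; rfl
  · have : c = c' := by linear_combination -h1
    subst this; rfl

/-- **The filed C⁺ of `vandermonde-patterned-arcs` holds trivially** (so its transfer stub is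
the crux in costume). Witness for slack `η`: `F = ZMod p`, `p` prime with `p - 1 ≥ 4^{1/η}`,
`n = 2`, `L = 1`, `S = {1}`. [new, elementary] -/
theorem patternedArcTight_trivial : PatternedArcTight := by
  intro η hη
  -- a prime `p ≥ max 5 (⌈4^{1/η}⌉₊ + 1)`
  obtain ⟨p, hpge, hp⟩ := Nat.exists_infinite_primes (max 5 (⌈(4 : ℝ) ^ (1 / η)⌉₊ + 1))
  haveI : Fact p.Prime := ⟨hp⟩
  have hp5 : 5 ≤ p := le_trans (le_max_left _ _) hpge
  have hpceil : ⌈(4 : ℝ) ^ (1 / η)⌉₊ + 1 ≤ p := le_trans (le_max_right _ _) hpge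
  refine ⟨ZMod p, inferInstance, inferInstance, inferInstance, 2, 1,
    fun _ => ![(1 : ZMod p), 0], fun _ => ![(1 : ZMod p), 1], fun _ => ![(0 : ZMod p), 1],
    {(1 : ZMod p)}, by simp, by simp, axes_isSTPP (ZMod p) ![1, 1], ?_, ?_, ?_⟩
  · -- leg sizes `p - 1`
    intro i
    have hfilt : (Finset.univ.filter (· ≠ (0 : ZMod p))).card = Fintype.card (ZMod p) - 1 := by
      rw [Finset.filter_ne', Finset.card_erase_of_mem (Finset.mem_univ _), Finset.card_univ]
    constructor
    · rw [Finset.card_image_of_injective _ ?_, hfilt]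
      intro a b hab
      have := congrFun hab 0
      simpa using this
    · rw [Finset.card_image_of_injective _ ?_, hfilt]
      intro a b hab
      have := congrFun hab 1
      simpa using this
  · rw [ZMod.card]; omega
  · -- packing: `p² ≤ (p-1)^{2+η}` once `(p-1)^η ≥ 4`
    rw [Fintype.card_fun, Fintype.card_fin, ZMod.card]
    push_cast
    have hp1 : 1 ≤ p := by omega
    rw [Nat.cast_sub hp1]
    push_cast
    set r : ℝ := (p : ℝ) - 1 with hr
    have hp5R : (5 : ℝ) ≤ p := by exact_mod_cast hp5
    have hr4 : (4 : ℝ) ≤ r := by rw [hr]; linarith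
    have hrpos : 0 < r := by linarith
    -- r ≥ 4^{1/η}
    have hceilR : (⌈(4 : ℝ) ^ (1 / η)⌉₊ : ℝ) + 1 ≤ p := by exact_mod_cast hpceil
    have hr_ge : (4 : ℝ) ^ (1 / η) ≤ r := by
      have := Nat.le_ceil ((4 : ℝ) ^ (1 / η))
      rw [hr]; linarith
    -- hence r^η ≥ 4
    have hrη : (4 : ℝ) ≤ r ^ η := by
      have h1 : ((4 : ℝ) ^ (1 / η)) ^ η ≤ r ^ η :=
        Real.rpow_le_rpow (by positivity) hr_ge hη.le
      have h2 : ((4 : ℝ) ^ (1 / η)) ^ η = 4 := by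
        rw [← Real.rpow_mul (by norm_num), one_div, inv_mul_cancel₀ hη.ne', Real.rpow_one]
      linarith [h1, h2]
    have hsplit : r ^ (2 + η) = r ^ 2 * r ^ η := by
      rw [Real.rpow_add hrpos, Real.rpow_two]
    rw [one_mul, hsplit]
    -- p² ≤ 4 r² ≤ r² r^η
    have hpr : (p : ℝ) = r + 1 := by rw [hr]; ring
    rw [hpr]
    nlinarith [sq_nonneg r, hrη, hr4, mul_le_mul_of_nonneg_left hrη (sq_nonneg r)]


/-! ## Part C — idea `label-weighted-stpp-debordering`: popular-class collapse; the sanity stub is false as typed -/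

/-- Verbatim from Ideator3Sketch. -/
def IsLabelWeightedSTPP {H : Type*} [AddCommGroup H] {L : ℕ} (A B C : Fin L → Finset H)
    (κ μ : Fin L → ℤ) : Prop :=
  (∀ i k, ∀ s ∈ A i, ∀ t ∈ B i, ∀ s' ∈ A k, ∀ t' ∈ B k, s - t = s' - t' → i = k ∧ s = s' ∧ t = t') ∧
  (∀ j k, ∀ t ∈ B j, ∀ u ∈ C j, ∀ t' ∈ B k, ∀ u' ∈ C k, t - u = t' - u' → j = k ∧ t = t' ∧ u = u') ∧
  (∀ i k, ∀ u ∈ C i, ∀ s ∈ A i, ∀ u' ∈ C k, ∀ s' ∈ A k, u - s = u' - s' → i = k ∧ u = u' ∧ s = s') ∧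
  (∀ i, ∀ s ∈ A i, ∀ s' ∈ A i, ∀ t ∈ B i, ∀ t' ∈ B i, ∀ u ∈ C i, ∀ u' ∈ C i,
      (s' - s) + (t' - t) + (u' - u) = 0 → s = s' ∧ t = t' ∧ u = u') ∧
  (∀ i j k : Fin L, ¬ (i = j ∧ j = k) →
      ∀ s ∈ A k, ∀ s' ∈ A i, ∀ t ∈ B i, ∀ t' ∈ B j, ∀ u ∈ C j, ∀ u' ∈ C k,
        (s' - s) + (t' - t) + (u' - u) = 0 → 1 ≤ (κ i - κ k) + (μ j - μ k))

/-- Verbatim from Ideator3Sketch. -/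
def STPPIsWeighted : Prop :=
  ∀ (H : Type) [AddCommGroup H] (L : ℕ) (A B C : Fin L → Finset H) (κ μ : Fin L → ℤ),
    IsSTPP A B C → IsLabelWeightedSTPP A B C κ μ

/-- **Popular-class collapse.** [new, elementary] -/
theorem isSTPP_comp_of_const_potentials {H : Type*} [AddCommGroup H] {L L' : ℕ}
    {A B C : Fin L → Finset H} {κ μ : Fin L → ℤ} (hW : IsLabelWeightedSTPP A B C κ μ)
    (ι : Fin L' → Fin L) (hι : Function.Injective ι)
    (hκ : ∀ a b : Fin L', κ (ι a) = κ (ι b)) (hμ : ∀ a b : Fin L', μ (ι a) = μ (ι b)) :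
    IsSTPP (fun a => A (ι a)) (fun a => B (ι a)) (fun a => C (ι a)) := by
  obtain ⟨-, -, -, hT, hX⟩ := hW
  intro i j k s hs s' hs' t ht t' ht' u hu u' hu' hrel
  by_cases hdiag : ι i = ι j ∧ ι j = ι k
  · obtain ⟨hij, hjk⟩ := hdiag
    have hij' : i = j := hι hij
    have hjk' : j = k := hι hjk
    subst hij'
    subst hjk'
    exact ⟨rfl, rfl, hT (ι i) s hs s' hs' t ht t' ht' u hu u' hu' hrel⟩
  · have h := hX (ι i) (ι j) (ι k) hdiag s hs s' hs' t ht t' ht' u hu u' hu' hrel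
    rw [hκ i k, hμ j k] at h
    simp at h

/-- **The sanity stub `STPPIsWeighted` is false as typed**: `H = ℤ`, two blocks with
`A = B = {0}` and EMPTY `C` — `IsSTPP` holds vacuously, packing clause (1) fails.
[small model] -/
theorem not_stppIsWeighted : ¬ STPPIsWeighted := by
  intro h
  have hS : IsSTPP (fun _ : Fin 2 => ({0} : Finset ℤ)) (fun _ => ({0} : Finset ℤ))
      (fun _ => (∅ : Finset ℤ)) := by
    intro i j k s _ s' _ t _ t' _ u hu
    simp at hu
  obtain ⟨h1, -, -, -, -⟩ :=
    h ℤ 2 (fun _ => {0}) (fun _ => {0}) (fun _ => ∅) (fun _ => 0) (fun _ => 0) hS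
  have h01 : (0 : Fin 2) = 1 :=
    (h1 0 1 0 (by simp) 0 (by simp) 0 (by simp) 0 (by simp) rfl).1
  exact absurd h01 (by decide)

/-- The repaired sanity statement: with all legs nonempty, `IsSTPP` families are label-weighted
for every choice of potentials. [new, elementary] -/
theorem isLabelWeightedSTPP_of_isSTPP {H : Type*} [AddCommGroup H] {L : ℕ}
    {A B C : Fin L → Finset H} (hS : IsSTPP A B C)
    (hA : ∀ i, (A i).Nonempty) (hB : ∀ i, (B i).Nonempty) (hC : ∀ i, (C i).Nonempty)
    (κ μ : Fin L → ℤ) : IsLabelWeightedSTPP A B C κ μ := by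
  refine ⟨?_, ?_, ?_, ?_, ?_⟩
  · intro i k s hs t ht s' hs' t' ht' he
    obtain ⟨u, hu⟩ := hC k
    have h0 : (s - s') + (t' - t) + (u - u) = 0 := by
      have : (s - s') + (t' - t) + (u - u) = (s - t) - (s' - t') := by abel
      rw [this, he, sub_self]
    obtain ⟨hik, -, hss, htt, -⟩ := hS i k k s' hs' s hs t ht t' ht' u hu u hu h0
    exact ⟨hik, hss.symm, htt⟩
  · intro j k t ht u hu t' ht' u' hu' he
    obtain ⟨s, hs⟩ := hA k
    -- pattern (k, j, k): `s = s' ∈ A k`, `t ∈ B k := t'`, `t' ∈ B j := t`, `u ∈ C j`, `u' ∈ C k`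
    have h0 : (s - s) + (t - t') + (u' - u) = 0 := by
      have : (s - s) + (t - t') + (u' - u) = (t - u) - (t' - u') := by abel
      rw [this, he, sub_self]
    obtain ⟨hkj, -, -, htt, huu⟩ := hS k j k s hs s hs t' ht' t ht u hu u' hu' h0
    exact ⟨hkj.symm, htt.symm, huu⟩
  · intro i k u hu s hs u' hu' s' hs' he
    obtain ⟨t, ht⟩ := hB i
    -- pattern (i, i, k): `s ∈ A k := s'`, `s' ∈ A i := s`, `t = t' ∈ B i`, `u ∈ C i`, `u' ∈ C k`
    have h0 : (s - s') + (t - t) + (u' - u) = 0 := by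
      have : (s - s') + (t - t) + (u' - u) = (u' - s') - (u - s) := by abel
      rw [this, he, sub_self]
    obtain ⟨-, hik, hss, -, huu⟩ := hS i i k s' hs' s hs t ht t ht u hu u' hu' h0
    exact ⟨hik, huu, hss.symm⟩
  · intro i s hs s' hs' t ht t' ht' u hu u' hu' h0
    obtain ⟨-, -, h⟩ := hS i i i s hs s' hs' t ht t' ht' u hu u' hu' h0
    exact h
  · intro i j k hne s hs s' hs' t ht t' ht' u hu u' hu' h0
    obtain ⟨hij, hjk, -⟩ := hS i j k s hs s' hs' t ht t' ht' u hu u' hu' h0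
    exact absurd ⟨hij, hjk⟩ hne

end Summit.MatrixMultiplication.MatrixMultiplication.Cruxes.ThinPackings.Triage2
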